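import Summits.BirchSwinnertonDyer.Rank1Residual.GaloisImage.KuriharaLowerBoundThree
import Summits.BirchSwinnertonDyer.Rank1Residual.GaloisImage.KatoKuriharaPortThreeWith
import Summits.BirchSwinnertonDyer.Rank1Residual.GaloisImage.KuriharaLowerBoundAssemblyAt
import HarnessLib

/-!
# P-KEYED twin of `KuriharaLowerBoundThree` — the two-level dictionary hypothesis `hdict` AT ONE PARAMETRISATION DATUM `P`
# (cell `b2b-bsdres`, team n1011; T-PORT-FIX (lead R5-112 (a) / R5-113 (a), joint text (ii-b)): the repaired
# port PORT″ `KatoKuriharaPortThreeAtWith₂ W t v₃ η P` unpacks to `KatoKuriharaDictionaryThreeAt₂At … P`, so the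
# lower-bound chain below the record corollary is re-keyed by ONE binder; seat p03 GEN 13 — BANKED bytes
# offered to the T-PORT-FIX owner n1011-p18, filed only on the owner's / lead's word)

HONEST FRAMING (cell `b2b-bsdres`, run/shared/lean/b2b/bsd-rank1-residual/, verbatim in every
file): the goal of the cell is to DELETE the COMBINATION-SHAPED residual classes of the
Birch–Swinnerton-Dyer formula for ALL analytic-rank `≤ 1` elliptic curves over `ℚ` — "full BSD
formula for every rank `≤ 1` curve in class `C`" assembled STRICTLY from published theorems — so
that the rank-`≤ 1` remainder becomes exactly the CONSTRUCTION-SHAPED classes, which are TYPED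
(missing-input `Prop`s), NOT attempted. This is not "finishing BSD". Team n1011 (N10/N11, the
additive block `X4 ∧ p = 3`): research route; no claim beyond the stated classes; the label X4 and
the mark of RESIDUAL-MAP §I N11 are UNCHANGED by this file; nothing is booked.  TOOL theorems only
(no definition, no named fact); CONDITIONAL exactly as `KuriharaLowerBoundThree.lean` EXCEPT that the two-level
dictionary hypothesis is the `P`-keyed `KatoKuriharaDictionaryThreeAt₂At W t k k′ D D′ red v₃ P`
(n1011-p18's PORT″ append to `GaloisImage/KatoKuriharaPortThreeWith.lean`, joint text of lead R5-112 (a)):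
binder diff EXACTLY {{`hdict : … KatoKuriharaDictionaryThreeAt₂ … v₃`}} ↦
{{`hdict : … KatoKuriharaDictionaryThreeAt₂At … v₃ P`}} at the theorem's own `P` (which already precedes
`hdict` in the signature); the ONE application `hdict … hv₃ P hcP hper` loses its `P`; every call into the
chain is re-pointed to the `_at` twin below; every other token is the original.  WHY: the universal-closure
PORT was shown UNSATISFIABLE on its population (n1011-p11 GEN 11, T-PORT-NEG p326481; r1 GEN 47 / referee-1
GEN 48 CONFIRMED); the repair displays ONE generator family `η` AND keys the dictionary at the record's own
parametrisation datum `P` so that its NAMED DISCHARGER (★ PK-6₂) reaches it with no lemma the tree lacks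
(DESIGN CRITERION OF RECORD, R5-112 (a)).  The original `∀ P` theorems stay (parents: `….at P`).

References: as `KuriharaLowerBoundThree.lean`; cells/n1011/PLAN.md R5-110 / R5-112 / R5-113; ROUTE-1.md §59–§60.
-/

noncomputable section

open scoped Classical NumberField ContRepresentation
open Function NumberField IsDedekindDomain WeierstrassCurve
  Literature.NumberTheory.EllipticCurves Literature.NumberTheory.EllipticCurves.ModularForms
  Literature.NumberTheory.EllipticCurves.Rank1Residual
  Literature.NumberTheory.GaloisRepresentations
  Literature.NumberTheory.GaloisRepresentations.DiscreteGaloisModule Literature.NumberTheory.GaloisCohomology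

namespace Summit.BirchSwinnertonDyer.Rank1Residual.GaloisImage.Assembly

/-- **P-KEYED twin of `padicValRat_le_of_certificate` (T-PORT-FIX, joint text (ii-b) of lead R5-112 (a) / R5-113 (a)):** binder diff EXACTLY {`hdict : … KatoKuriharaDictionaryThreeAt₂ … v₃`} ↦ {`hdict : … KatoKuriharaDictionaryThreeAt₂At … v₃ P`} at this theorem's own `P`; conclusion and every other binder identical; the original docstring follows verbatim.
**(C20) at `p = 3` in datum currency — the END THEOREM of sub-route (a′) modulo its named typed
inputs** (module docstring; (B6): on `t = 1` rows supply `D ⊆ 𝒫_{k+1+t}`, `D′ ⊆ 𝒫_{k′+1+t}`).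
[cite: Kim2022StructureSelmer, Thm. 1.9 (6) and Thm. 3.13] [cite: Sakamoto2024, Thm. 4.4 (p. 926)]
[cite: MazurRubin2004, Thm. 3.2.4 and App. A (33)] -/
theorem padicValRat_le_of_certificate_at
    (W : WeierstrassCurve ℚ) [W.IsElliptic] [W.IsGloballyMinimal] (t k : ℕ)
    (D : KolyvaginDatum (W.torsionGaloisModule (((3 : ℕ) : ℤ) ^ k * ((3 : ℕ) : ℤ))))
    (v₃ : HeightOneSpectrum (𝓞 ℚ)) (hv₃ : ((3 : ℕ) : 𝓞 ℚ) ∈ v₃.asIdeal)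
    -- the row
    (hadd : Addv W 3) (hc3 : ¬ 3 ∣ (W.baseChange ℚ_[3]).localTamagawaNumber ℤ_[3])
    (hsurj : W.HasSurjectiveModNGaloisRep ((3 : ℕ) : ℤ))
    (ht : Nat.card {Q : (W.baseChange ℚ_[3]).toAffine.Point // (3 : ℕ) • Q = 0} = 3 ^ t)
    (hL : W.entireLFunction 1 ≠ 0) [Finite W.toAffine.Point] [Finite W.sha]
    {N : ℕ} [NeZero N] (P : ModularParametrizationData W N) (hcP : ¬ ((3 : ℕ) : ℤ) ∣ P.maninConstant)
    (hper : ∃ u : ℚ, ‖(u : ℚ_[3])‖ = 1 ∧ W.realPeriodRat = u * plusPeriod P.f)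
    -- generator of `KS₁` at the shallow depth
    (g : Finset (HeightOneSpectrum (𝓞 ℚ)) →
      galoisCohomology (W.torsionGaloisModule (((3 : ℕ) : ℤ) ^ k * ((3 : ℕ) : ℤ))) 1)
    (hgen : ∀ κ ∈ D.kolyvaginSystems (propagatedSelmerStructure W 3 k), ∃ a : ℕ, κ = a • g)
    -- the deep inputs, at every depth `k′`
    (D' : ∀ k' : ℕ, KolyvaginDatum (W.torsionGaloisModule (((3 : ℕ) : ℤ) ^ k' * ((3 : ℕ) : ℤ))))
    (red : ∀ k' : ℕ, (W.torsionGaloisModule (((3 : ℕ) : ℤ) ^ k' * ((3 : ℕ) : ℤ))).toContRepresentation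
      →ⁱL (W.torsionGaloisModule (((3 : ℕ) : ℤ) ^ k * ((3 : ℕ) : ℤ))).toContRepresentation)
    (hred : ∀ k', ∀ x : geomTorsion W (((3 : ℕ) : ℤ) ^ k' * ((3 : ℕ) : ℤ)),
      ((red k' x : geomTorsion W (((3 : ℕ) : ℤ) ^ k * ((3 : ℕ) : ℤ))) : geomPoints W) =
        (((3 : ℕ) : ℤ) ^ (k' - k)) • (x : geomPoints W))
    (hdict : ∀ k', k ≤ k' → KatoKuriharaDictionaryThreeAt₂At W t k k' D (D' k') (red k') v₃ P)
    (g' : ∀ k' : ℕ, Finset (HeightOneSpectrum (𝓞 ℚ)) →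
      galoisCohomology (W.torsionGaloisModule (((3 : ℕ) : ℤ) ^ k' * ((3 : ℕ) : ℤ))) 1)
    (hg' : ∀ k', g' k' ∈ (D' k').kolyvaginSystems (propagatedSelmerStructure W 3 k'))
    (hgen' : ∀ k', ∀ κ ∈ (D' k').kolyvaginSystems (propagatedSelmerStructure W 3 k'),
      ∃ a : ℕ, κ = a • g' k')
    (inv' : ∀ k' : ℕ, LocalInvariants ℚ (3 ^ (k' + 1))) (hperf' : ∀ k', (inv' k').IsPerfect)
    (hsum' : ∀ k', (inv' k').SumLocalTermEqZero) (hcompl' : ∀ k', (inv' k').SelmerComplement)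
    (hinj' : ∀ k', ∀ v : HeightOneSpectrum (𝓞 ℚ), Injective (inv' k' (Sum.inr v)))
    (hEP : ∀ v : HeightOneSpectrum (𝓞 ℚ), localEulerPoincareCharacteristic (v.adicCompletion ℚ))
    (T : ∀ k' : ℕ, Finset (HeightOneSpectrum (𝓞 ℚ))) (hv₃T : ∀ k', v₃ ∈ T k')
    (hT : ∀ k', ∀ v : HeightOneSpectrum (𝓞 ℚ), v ∉ T k' →
      (((3 ^ (k' + 1) : ℕ) : ℕ) : 𝓞 ℚ) ∉ v.asIdeal ∧
        GaloisRep.IsUnramifiedAt v (W.torsionGaloisModule (((3 : ℕ) : ℤ) ^ k' * ((3 : ℕ) : ℤ))))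
    (h𝓕T : ∀ k', (propagatedSelmerStructure W 3 k').IsUnramifiedOutside (finSupport (T k')))
    (h𝓚T : ∀ k', (W.kummerSelmerStructure (((3 : ℕ) : ℤ) ^ k' * ((3 : ℕ) : ℤ))).IsUnramifiedOutside
      (finSupport (T k')))
    (hfinT : ∀ k', Finite (geomTorsion W (((3 : ℕ) : ℤ) ^ k' * ((3 : ℕ) : ℤ))))
    (hfinS : ∀ k', Finite (W.kummerSelmerStructure (((3 : ℕ) : ℤ) ^ k' * ((3 : ℕ) : ℤ))).selmerGroup)
    (hR22 : ∀ k', (Nat.card ((inv' k').dualSelmerStructure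
          (W.torsionGaloisModule (((3 : ℕ) : ℤ) ^ k' * ((3 : ℕ) : ℤ)))
          (propagatedSelmerStructure W 3 k')).selmerGroup ∣ 3 ^ (k' + 1) →
        addOrderOf (g' k' ∅) * Nat.card ((inv' k').dualSelmerStructure
          (W.torsionGaloisModule (((3 : ℕ) : ℤ) ^ k' * ((3 : ℕ) : ℤ)))
            (propagatedSelmerStructure W 3 k')).selmerGroup = 3 ^ (k' + 1)) ∧
      (3 ^ (k' + 1) ∣ Nat.card ((inv' k').dualSelmerStructure
          (W.torsionGaloisModule (((3 : ℕ) : ℤ) ^ k' * ((3 : ℕ) : ℤ)))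
            (propagatedSelmerStructure W 3 k')).selmerGroup → g' k' ∅ = 0))
    (hNp : ∀ k', ∃ l, Nat.card ((inv' k').dualSelmerStructure
        (W.torsionGaloisModule (((3 : ℕ) : ℤ) ^ k' * ((3 : ℕ) : ℤ)))
          (propagatedSelmerStructure W 3 k')).selmerGroup = 3 ^ l)
    (htr : ∀ k', k ≤ k' → ∀ (κ' : Finset (HeightOneSpectrum (𝓞 ℚ)) →
        galoisCohomology (W.torsionGaloisModule (((3 : ℕ) : ℤ) ^ k * ((3 : ℕ) : ℤ))) 1)
      (κu' : Finset (HeightOneSpectrum (𝓞 ℚ)) →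
        galoisCohomology (W.torsionGaloisModule (((3 : ℕ) : ℤ) ^ k' * ((3 : ℕ) : ℤ))) 1)
      (a a' : ℕ), κ' ∈ D.kolyvaginSystems (propagatedSelmerStructure W 3 k) →
        κu' ∈ (D' k').kolyvaginSystems (propagatedSelmerStructure W 3 k') →
        κ' = a • g → κu' = a' • g' k' →
        (∀ d, (D' k').IsLevel d → D.IsLevel d → galoisCohomology.map (red k') 1 (κu' d) = κ' d) →
        ∀ s, s ≤ k + 1 → (3 ^ s ∣ a ↔ 3 ^ s ∣ a'))
    -- the certificate at a level `n` of `D`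
    (n : Finset (HeightOneSpectrum (𝓞 ℚ))) (hn : D.IsLevel n) {j : ℕ} (htj : t + j ≤ k + 1)
    (hPN : ∀ q ∈ n, (Ideal.absNorm q.asIdeal).Coprime N)
    {ψ₀ : (ℓ : ℕ) → (ZMod ℓ)ˣ →* Multiplicative (ZMod (3 ^ j))}
    (hψ₀ : ∀ q ∈ n, Function.Surjective (ψ₀ (Ideal.absNorm q.asIdeal)))
    (hcert : haveI : NeZero (∏ q ∈ n, Ideal.absNorm q.asIdeal) :=
        ⟨Finset.prod_ne_zero_iff.2 fun q _ => absNorm_ne_zero q⟩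
      kuriharaNumber P.f (3 ^ j) (∏ q ∈ n, Ideal.absNorm q.asIdeal) ψ₀ ≠ 0)
    (hv : ∀ c, c ⊂ n → c.Nonempty → ∀ ψ' : (ℓ : ℕ) → (ZMod ℓ)ˣ →* Multiplicative (ZMod (3 ^ j)),
      (∀ q ∈ c, Function.Surjective (ψ' (Ideal.absNorm q.asIdeal))) →
        haveI : NeZero (∏ q ∈ c, Ideal.absNorm q.asIdeal) :=
          ⟨Finset.prod_ne_zero_iff.2 fun q _ => absNorm_ne_zero q⟩
        kuriharaNumber P.f (3 ^ j) (∏ q ∈ c, Ideal.absNorm q.asIdeal) ψ' = 0) :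
    ∃ q : ℚ, W.entireLFunction 1 / (W.realPeriodRat : ℂ) = (q : ℂ) ∧
      padicValRat 3 q ≤
        (padicValNat 3 (Nat.card (AddCommGroup.primaryComponent W.sha 3)) : ℤ) + ((j - 1 : ℕ) : ℤ) := by
  haveI : Fact (Nat.Prime 3) := ⟨Nat.prime_three⟩
  haveI : NeZero ((3 : ℕ) : ℚ) := ⟨by norm_num⟩
  have hirr : W.HasIrreducibleModPGaloisRep 3 :=
    hasIrreducibleModPGaloisRep_of_hasSurjectiveModNGaloisRep W 3 hsurj
  -- the `L`-value witness
  obtain ⟨q, v, hq, hvq, hKur⟩ := LValue.exists_lValue_witness W 3 (by norm_num) hirr hL P hper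
  refine ⟨q, hq, ?_⟩
  rw [hvq]
  -- `#Ш[3^∞] = 3^X`
  set X := padicValNat 3 (Nat.card W.sha) with hXdef
  have hSha : Nat.card (AddCommGroup.primaryComponent W.sha 3) = 3 ^ X :=
    natCard_primaryComponent_eq_pow_padicValNat 3
  rw [hSha, padicValNat.prime_pow]
  -- trivial when `v < j`
  rcases Nat.lt_or_ge v j with hvj | hjv
  · have : (v : ℤ) ≤ ((j - 1 : ℕ) : ℤ) := by exact_mod_cast (by omega : v ≤ j - 1)
    have hX0 : (0 : ℤ) ≤ (X : ℤ) := by positivity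
    linarith
  -- the deep level
  set k' := max k (X + t + v) with hk'
  have hkk' : k ≤ k' := le_max_left _ _
  have hK : X + t + v < k' + 1 := Nat.lt_succ_of_le (le_max_right _ _)
  haveI := hfinT k'
  haveI := hfinS k'
  obtain ⟨hSdvd, hSkill⟩ := SelmerSha.card_dvd_and_nsmul_eq_zero W 3 hirr k'
  rw [hSha] at hSdvd hSkill
  -- the `3`-integrality of the symbols at the sub-levels of `n`
  have hden : ∀ d ⊆ n, ∀ a : ℕ,
      (ratPlusSymbol P.f ((a : ℚ) / (∏ q ∈ d, Ideal.absNorm q.asIdeal : ℕ))).den.Coprime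
        (3 ^ (k + 1)) := by
    intro d hd a
    refine LValue.coprime_den_ratPlusSymbol_of_coprime W 3 (by norm_num) hirr P ?_ (k + 1) a
    exact Nat.Coprime.prod_left fun q hq => hPN q (hd hq)
  -- hypothesis (v) at every proper sub-level, the empty one from `v ≥ j`
  have hv' : ∀ c, c ⊂ n → ∀ ψ' : (ℓ : ℕ) → (ZMod ℓ)ˣ →* Multiplicative (ZMod (3 ^ j)),
      (∀ q ∈ c, Function.Surjective (ψ' (Ideal.absNorm q.asIdeal))) →
        haveI : NeZero (∏ q ∈ c, Ideal.absNorm q.asIdeal) :=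
          ⟨Finset.prod_ne_zero_iff.2 fun q _ => absNorm_ne_zero q⟩
        kuriharaNumber P.f (3 ^ j) (∏ q ∈ c, Ideal.absNorm q.asIdeal) ψ' = 0 := by
    intro c hc ψ' hψ'
    rcases c.eq_empty_or_nonempty with rfl | hne
    · -- `δ̃_1^{(j)} = 3^v · unit = 0` in `ℤ/3^j` since `v ≥ j`
      obtain ⟨w₀, hw₀⟩ := hKur j
      have h1 : kuriharaNumber P.f (3 ^ j) 1 ψ' = 0 := by
        rw [hw₀ ψ', show ((3 ^ v : ℕ) : ZMod (3 ^ j)) = 0 from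
          (ZMod.natCast_eq_zero_iff _ _).2 (Nat.pow_dvd_pow 3 hjv), zero_mul]
      simpa using h1
    · exact hv c hc hne ψ' hψ'
  -- the ASSEMBLY at depth `k′`
  have hmain := pow_dvd_natCard_selmerGroup_of_certificate_at W t k k' hkk' D (D' k') (red k') (hred k')
    v₃ hv₃ hadd hc3 hsurj ht P hcP hper (hdict k' hkk') g hgen (g' k') (hg' k') (hgen' k') (inv' k')
    (hperf' k') (hsum' k') (hcompl' k') (hinj' k') hEP (T k') (hv₃T k') (hT k') (h𝓕T k') (h𝓚T k')
    (hR22 k') (hNp k') (htr k' hkk') n hn htj hden hψ₀ hcert hv' (hKur (k' + 1)) hSkill hK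
  -- `3^{v+1−j} ∣ #Sel ∣ 3^X`
  have h := (Nat.pow_dvd_pow_iff_le_right (by norm_num : 1 < 3)).1 (hmain.trans hSdvd)
  have : (v : ℤ) ≤ (X : ℤ) + ((j - 1 : ℕ) : ℤ) := by
    have h' : v + 1 - j ≤ X := h
    push_cast [Nat.sub_le_iff_le_add] at h' ⊢
    omega
  exact this

end Summit.BirchSwinnertonDyer.Rank1Residual.GaloisImage.Assembly

end
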